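import Literature.Computability.Cryptography.ClassicalBasePromise
import Literature.Computability.QuantumComplexity.FBQPOracleAccess
import Literature.Computability.Complexity.PromiseRPAmplification
import HarnessLib

/-!
# One-sided trials against a `BQP` language: bits computed by adaptive programs, and amplification from `1/poly`

Topic `Literature/Computability/Cryptography`, continuing `ClassicalBasePromise.lean`
(`mem_PromiseBQP_of_FPRel_decider_oneSided`: a randomised polynomial-time machine with one `BQP` oracle whose
first output bit is `1` with probability `≥ 3/4` on yes-instances and `0` always on no-instances decides a
promise problem in `PromiseBQP`) and `FBQPOracleAccess.lean` (`AdQuery.AdPres.batch`: parallel queries are an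
adaptive `FP` program). Two closure principles of the oracle model `BPP^{BQP} = BQP`
(Bennett–Bernstein–Brassard–Vazirani 1997, Cor. 4.15) in the shape used by torsion-witness and similar
"draw a candidate, test it with a quantum subroutine" algorithms, proved definition-free:

* `mem_BQP_of_adPres_bit` — **a bit computed by an adaptive `FP` program over a `BQP` language defines a
  `BQP` language**: if `h` is presented over `A ∈ BQP` (`AdQuery.AdPres A h`) and `h w = [bit w]` for all `w`,
  then `{w | bit w} ∈ BQP` (`isQSolvable_of_mem_FPRel_BQP_holds` + `mem_BQP_of_isQSolvable_bit`);
* `mem_PromiseBQP_of_oneSided_trials` — **one-sided amplification from inverse-polynomial success**: if a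
  TRIAL LANGUAGE `T ∈ BQP` accepts `⟨x, z⟩` for at least a `1/(N(|x|)+1)` fraction of the blocks
  `z ∈ {0,1}^{β(|x|)}` whenever `x` is a yes-instance of length `≥ n₀`, and accepts no `⟨x, z⟩` at all when `x`
  is a no-instance, then the promise problem is in `PromiseBQP`: the machine asks the `2(N+1)` blocks of its
  coin string in parallel and outputs their disjunction (`(1 − 1/(N+1))^{2(N+1)} ≤ 1/4`,
  `CoinBlocks.cnt_allBlocks_eq_pow`, `one_sub_inv_pow_le_half`), the finitely many short yes-instances being
  tabulated (Arora–Barak 2009, §7.4.1: error reduction for one-sided error).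

## References

* C. H. Bennett, E. Bernstein, G. Brassard, U. Vazirani, *Strengths and weaknesses of quantum computing*,
  SIAM J. Comput. 26 (1997) 1510–1523, §4, Cor. 4.15 [BennettBernsteinBrassardVazirani1997].
* S. Arora, B. Barak, *Computational Complexity: A Modern Approach*, CUP 2009, §7.4.1 (error reduction by
  independent repetitions), §3.4 (oracle machines) [AroraBarakCC2009].
* J. Watrous, *Quantum computational complexity*, in: Encyclopedia of Complexity and Systems Science,
  Springer (2009), §III.2 (promise problems) [Watrous2009].
-/

noncomputable section

namespace Literature.Computability.Cryptography

open _root_.Computability Polynomial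
open Literature.Computability.Complexity Literature.Computability.Complexity.Brick
open Literature.Computability.Complexity.CodeFP Literature.Computability.Complexity.AdQuery
open Literature.Computability.Complexity.CoinBlocks Literature.Computability.QuantumComplexity
open Literature.Computability.Complexity.Plumb (polyFn polyFn_mem_FP polyFn_apply)
open HashBricks (blk)

/-! ### A bit computed by an adaptive program over a `BQP` language -/

/-- **A bit computed by an adaptive `FP` program over a `BQP` language defines a `BQP` language.** If `h` is
presented over `A ∈ BQP` and writes the single bit `bit w` on every input `w`, then `{w | bit w} ∈ BQP`:
`h ∘ fst ∈ FP^A` solves the extension-closed relation `{z | [bit w] ≤ z}` on every coin string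
(`isQSolvable_of_mem_FPRel_BQP_holds`), and the language is read off the written bit
(`mem_BQP_of_isQSolvable_bit`). [cite: BennettBernsteinBrassardVazirani1997, Cor. 4.15 (BQP^BQP = BQP)] -/
theorem mem_BQP_of_adPres_bit {A : Language Bool} {h : List Bool → List Bool} {bit : List Bool → Bool}
    (hh : AdPres A h) (hA : A ∈ BQP) (hbit : ∀ w, h w = [bit w]) : {w : List Bool | bit w = true} ∈ BQP := by
  have hT : h ∘ fstF ∈ FPRel (Oracle.ofLanguage A) := comp_FP_mem_FPRel hh.mem_FPRel fstF_mem_FP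
  have hsolv : IsQSolvable fun x => {z | [bit x] <+: z} := by
    refine isQSolvable_of_mem_FPRel_BQP_holds A _ 0 (fun x => {z | [bit x] <+: z})
      (fun x y hy z hyz => List.IsPrefix.trans hy hyz) hA hT fun x => ?_
    have hset : {c : List Bool | (h ∘ fstF) (boolPair x c) ∈ {z | [bit x] <+: z}} = Set.univ :=
      Set.eq_univ_of_forall fun c => by
        simp only [Set.mem_setOf_eq, Function.comp_apply, fstF_boolPair, hbit]
        exact List.prefix_rfl
    rw [hset, uniformProb_univ]
    norm_num
  exact mem_BQP_of_isQSolvable_bit (fun _ _ => QCircuit.outputPMF_apply_holds) cliffordT_isUnitary_holds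
    (fun w => Iff.rfl) hsolv

/-! ### The block machine -/

/-- **The block query maker** (`FP`): `⟨⟨x, c⟩, bin i⟩ ↦ ⟨x, block i of c⟩`, blocks of length `β(|x|)`
(`blk c β i = (c ⇂ iβ) ↾ β`). [cite: AroraBarakCC2009, §7.4.1] -/
theorem blockQuery_exists (β : Polynomial ℕ) : ∃ f : List Bool → List Bool, f ∈ FP ∧
    ∀ (x c : List Bool) (i : ℕ), f (boolPair (boolPair x c) (encodeNat i)) = boolPair x (blk c (β.eval x.length) i) := by
  have cX : CodeFP (pairE strE natE) strE (fun p => fstF p.1) := ⟨fstF ∘ fstF, comp_mem_FP fstF_mem_FP fstF_mem_FP,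
    fun p => by simp⟩
  have cC : CodeFP (pairE strE natE) strE (fun p => sndF p.1) := ⟨sndF ∘ fstF, comp_mem_FP sndF_mem_FP fstF_mem_FP,
    fun p => by simp⟩
  have cBu : CodeFP (pairE strE natE) unE (fun p => β.eval (fstF p.1).length) :=
    CodeFP.comp (β := List Bool) (eβ := strE) ⟨polyFn β, polyFn_mem_FP β, fun w => by
      rw [polyFn_apply, ← unE_eq_ones]⟩ cX
  have cOff : CodeFP (pairE strE natE) unE (fun p => min (p.2 * β.eval (fstF p.1).length) (sndF p.1).length) :=
    unOfNatMin.comp ((strLength.comp cC).pair (natMul.comp ((snd _ _).pair (natOfUn.comp cBu))))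
  have cDrop : CodeFP (pairE strE natE) strE
      (fun p => (sndF p.1).drop (min (p.2 * β.eval (fstF p.1).length) (sndF p.1).length)) :=
    strDrop.comp (cOff.pair cC)
  have cBlk : CodeFP (pairE strE natE) strE
      (fun p => ((sndF p.1).drop (min (p.2 * β.eval (fstF p.1).length) (sndF p.1).length)).take
        (β.eval (fstF p.1).length)) := strTake.comp (cBu.pair cDrop)
  obtain ⟨f, hf, hfs⟩ := (cX.pair cBlk).recodeOut (eγ := strE) (g' := fun p => boolPair (fstF p.1)
    (((sndF p.1).drop (min (p.2 * β.eval (fstF p.1).length) (sndF p.1).length)).take (β.eval (fstF p.1).length)))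
    fun p => rfl
  refine ⟨f, hf, fun x c i => ?_⟩
  have h := hfs (boolPair x c, i)
  simp only [pairE_apply, strE, id, fstF_boolPair, sndF_boolPair] at h
  rw [show natE i = encodeNat i from rfl] at h
  rw [h, blk]
  congr 2
  rcases le_total (i * β.eval x.length) c.length with hle | hle
  · rw [min_eq_left hle]
  · rw [min_eq_right hle, List.drop_length, List.drop_eq_nil_of_le hle]

/-- A bit string has a set bit iff its value is non-zero. [folklore] -/
theorem any_id_eq_decide_bitsToNat (s : List Bool) : s.any id = !decide (bitsToNat s = 0) := by
  induction s with
  | nil => rfl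
  | cons b s ih =>
    rw [List.any_cons, ih, bitsToNat_cons]
    cases b <;> cases h : decide (bitsToNat s = 0) <;> simp_all

/-- **The output map** (`FP`): `⟨⟨x, c⟩, bits⟩ ↦ [x ∈ table]` if `|x| < n₀`, else `[some bit is set]`.
[cite: AroraBarakCC2009, §7.4.1] -/
theorem blockOut_exists (n₀ : ℕ) (tbl : List (List Bool)) : ∃ g : List Bool → List Bool, g ∈ FP ∧
    ∀ (x c bits : List Bool), g (boolPair (boolPair x c) bits) =
      [if x.length < n₀ then decide (x ∈ tbl) else bits.any id] := by
  have cX : CodeFP (pairE strE strE) strE (fun p => fstF p.1) := ⟨fstF ∘ fstF, comp_mem_FP fstF_mem_FP fstF_mem_FP,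
    fun p => by simp⟩
  have cLt : CodeFP (pairE strE strE) bitE (fun p => decide ((fstF p.1).length < n₀)) :=
    natLt.comp ((strNatLength.comp cX).pair (const _ n₀))
  have cMem : CodeFP (pairE strE strE) bitE (fun p => decide (fstF p.1 ∈ tbl)) :=
    (mem (eα := strE) fun _ _ h => h).comp (cX.pair (const _ tbl))
  have cAny : CodeFP (pairE strE strE) bitE (fun p => p.2.any id) :=
    ((natEq.comp ((strVal.comp (snd _ _)).pair (const _ 0))).not).congr fun p => (any_id_eq_decide_bitsToNat _).symm
  obtain ⟨g, hg, hgs⟩ := cLt.ite cMem cAny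
  refine ⟨g, hg, fun x c bits => ?_⟩
  have h := hgs (boolPair x c, bits)
  simp only [pairE_apply, strE, id, fstF_boolPair] at h
  rw [h, bitE]
  by_cases hx : x.length < n₀
  · rw [decide_eq_true hx, if_pos hx]; rfl
  · rw [decide_eq_false hx, if_neg hx]; rfl

/-! ### One-sided amplification from inverse-polynomial success -/

/-- **One-sided trials against a `BQP` language decide a promise problem in `PromiseBQP`.** Let `T ∈ BQP` (the
trial language), `β, N` polynomials and `n₀` a threshold such that: for every yes-instance `x` with `|x| ≥ n₀`
at least a `1/(N(|x|)+1)` fraction of the blocks `z ∈ {0,1}^{β(|x|)}` have `⟨x, z⟩ ∈ T`, and for every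
no-instance `x` no `⟨x, z⟩` is in `T`. Then the (disjoint) promise problem is in `PromiseBQP`: the oracle
machine with `2(N(|x|)+1)·β(|x|)` coins asks its `2(N+1)` blocks in parallel (`AdPres.batch`, an `FP^T`
function) and accepts iff some block is accepted — on yes-instances it fails with probability
`≤ (1 − 1/(N+1))^{2(N+1)} ≤ 1/4` (`cnt_allBlocks_eq_pow`, `one_sub_inv_pow_le_half`), on no-instances never; the
yes-instances shorter than `n₀` are tabulated —, so `mem_PromiseBQP_of_FPRel_decider_oneSided` applies.
[cite: AroraBarakCC2009, §7.4.1 (error reduction for one-sided error)] -/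
theorem mem_PromiseBQP_of_oneSided_trials (Q : PromiseProblem) (hQ : Disjoint Q.yes Q.no)
    {T : Language Bool} (hT : T ∈ BQP) (β N : Polynomial ℕ) (n₀ : ℕ)
    (hyes : ∀ x ∈ Q.yes, n₀ ≤ x.length →
      1 / (((N.eval x.length : ℕ) : ℝ) + 1) ≤ uniformProb (β.eval x.length) {z | boolPair x z ∈ T})
    (hno : ∀ x ∈ Q.no, ∀ z : List Bool, boolPair x z ∉ T) : Q ∈ PromiseBQP := by
  classical
  -- the table of short yes-instances
  have hfin : {x : List Bool | x ∈ Q.yes ∧ x.length < n₀}.Finite :=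
    (List.finite_length_lt Bool n₀).subset fun x hx => hx.2
  set tbl : List (List Bool) := hfin.toFinset.toList with htbl
  have hmem_tbl : ∀ x, x ∈ tbl ↔ x ∈ Q.yes ∧ x.length < n₀ := fun x => by
    rw [htbl, Finset.mem_toList, Set.Finite.mem_toFinset]; rfl
  -- the machine
  set K : Polynomial ℕ := 2 * (N + 1) with hK
  obtain ⟨f, hf, hfs⟩ := blockQuery_exists β
  obtain ⟨g, hg, hgs⟩ := blockOut_exists n₀ tbl
  have hB := AdPres.batch (A := T) hf K
  have hG := hB.FP_comp hg
  have hGx : ∀ x c : List Bool, (g ∘ fun w => boolPair w ((List.range (K.eval w.length)).map fun i =>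
      T.boolIndicator (f (boolPair w (encodeNat i))))) (boolPair x c) =
      [if x.length < n₀ then decide (x ∈ tbl) else
        ((List.range (K.eval (boolPair x c).length)).map fun i =>
          T.boolIndicator (boolPair x (blk c (β.eval x.length) i))).any id] := by
    intro x c
    rw [Function.comp_apply, hgs]
    simp only [hfs]
  refine mem_PromiseBQP_of_FPRel_decider_oneSided Q hQ hT _ (K * β) hG.mem_FPRel (fun x hx => ?_) (fun x hx c => ?_)
  · -- yes side
    by_cases hn : x.length < n₀
    · have hset : {c : List Bool | [true] <+: (g ∘ fun w => boolPair w ((List.range (K.eval w.length)).map fun i =>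
          T.boolIndicator (f (boolPair w (encodeNat i))))) (boolPair x c)} = Set.univ :=
        Set.eq_univ_of_forall fun c => by
          rw [Set.mem_setOf_eq, hGx, if_pos hn, decide_eq_true ((hmem_tbl x).2 ⟨hx, hn⟩)]
      rw [hset, uniformProb_univ]
      norm_num
    · push Not at hn
      set n := x.length with hn'
      set ℓ := β.eval n with hℓ
      set Kn := K.eval n with hKn
      set B : Set (List Bool) := {z | boolPair x z ∈ T} with hBdef
      -- the accepting coin strings contain those with an accepted block among the first `K(n)`
      set E : Set (List Bool) := {c | ∃ j, j < Kn ∧ blk c ℓ j ∈ B} with hE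
      have hsub : E ⊆ {c : List Bool | [true] <+: (g ∘ fun w => boolPair w ((List.range (K.eval w.length)).map
          fun i => T.boolIndicator (f (boolPair w (encodeNat i))))) (boolPair x c)} := by
        rintro c ⟨j, hj, hjB⟩
        rw [Set.mem_setOf_eq, hGx, if_neg (not_lt.2 hn)]
        have hjK : j < K.eval (boolPair x c).length :=
          hj.trans_le (TM2Iter.eval_mono K (by rw [length_boolPair]; omega))
        have hany : (((List.range (K.eval (boolPair x c).length)).map fun i =>
            T.boolIndicator (boolPair x (blk c (β.eval x.length) i))).any id) = true := by
          rw [List.any_eq_true]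
          exact ⟨true, List.mem_map.2 ⟨j, List.mem_range.2 hjK, (Set.mem_iff_boolIndicator _ _).1 hjB⟩, rfl⟩
        rw [hany]
      have hmono : uniformProb (Kn * ℓ) E ≤ uniformProb (Kn * ℓ) {c : List Bool | [true] <+: (g ∘ fun w =>
          boolPair w ((List.range (K.eval w.length)).map fun i => T.boolIndicator (f (boolPair w (encodeNat i)))))
            (boolPair x c)} := by
        unfold uniformProb
        refine div_le_div_of_nonneg_right ?_ (by positivity)
        exact_mod_cast Finset.card_le_card fun r hr => by
          simp only [Finset.mem_filter, Finset.mem_univ, true_and] at hr ⊢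
          exact hsub hr
      have heval : (K * β).eval x.length = Kn * ℓ := by rw [eval_mul]
      rw [heval]
      refine le_trans ?_ hmono
      -- all blocks fail rarely
      have hcompl : Eᶜ = allBlocks ℓ Kn Bᶜ := by
        ext c; simp only [hE, allBlocks, Set.mem_compl_iff, Set.mem_setOf_eq, not_exists, not_and]
      have hcnt : cnt (Kn * ℓ) Eᶜ = cnt ℓ Bᶜ ^ Kn := by rw [hcompl, cnt_allBlocks_eq_pow]
      have hbad : uniformProb (Kn * ℓ) Eᶜ = (uniformProb ℓ Bᶜ) ^ Kn := by
        rw [uniformProb_eq_cnt_div, uniformProb_eq_cnt_div, hcnt, div_pow, ← pow_mul, mul_comm ℓ Kn]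
        push_cast
        rfl
      have hBc : uniformProb ℓ Bᶜ = 1 - uniformProb ℓ B := Complexity.uniformProb_compl ℓ B
      have hB1 : uniformProb ℓ B ≤ 1 := uniformProb_le_one ℓ B
      have hNinv : 1 / (((N.eval n : ℕ) : ℝ) + 1) ≤ uniformProb ℓ B := hyes x hx hn
      have hN1 : (1 : ℝ) ≤ ((N.eval n : ℕ) : ℝ) + 1 := by
        have : (0 : ℝ) ≤ ((N.eval n : ℕ) : ℝ) := Nat.cast_nonneg _
        linarith
      have hKn2 : Kn = (N.eval n + 1) * 2 := by rw [hKn, hK]; simp [eval_mul]; ring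
      have hpow : (uniformProb ℓ Bᶜ) ^ Kn ≤ 1 / 4 := by
        rw [hBc, hKn2, pow_mul]
        have h1 : (1 - uniformProb ℓ B) ^ (N.eval n + 1) ≤ 1 / 2 := by
          calc (1 - uniformProb ℓ B) ^ (N.eval n + 1) ≤ (1 - 1 / ((N.eval n + 1 : ℕ) : ℝ)) ^ (N.eval n + 1) := by
                apply pow_le_pow_left₀ (by linarith)
                push_cast
                linarith
            _ ≤ 1 / 2 := one_sub_inv_pow_le_half (Nat.succ_le_succ (Nat.zero_le _))
        have h0 : 0 ≤ (1 - uniformProb ℓ B) ^ (N.eval n + 1) := pow_nonneg (by linarith) _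
        nlinarith
      have hEc : uniformProb (Kn * ℓ) E = 1 - uniformProb (Kn * ℓ) Eᶜ := by rw [Complexity.uniformProb_compl]; ring
      rw [hEc, hbad]
      linarith
  · -- no side: every block is rejected, and the table holds no no-instance
    rw [hGx]
    by_cases hn : x.length < n₀
    · rw [if_pos hn]
      have : x ∉ tbl := fun h => Set.disjoint_left.1 hQ ((hmem_tbl x).1 h).1 hx
      rw [decide_eq_false this]
    · rw [if_neg hn]
      have hall : (((List.range (K.eval (boolPair x c).length)).map fun i =>
          T.boolIndicator (boolPair x (blk c (β.eval x.length) i))).any id) = false := by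
        rw [List.any_eq_false]
        intro b hb
        obtain ⟨i, -, rfl⟩ := List.mem_map.1 hb
        rw [(Set.notMem_iff_boolIndicator _ _).1 (hno x hx _)]
        decide
      rw [hall]

end Literature.Computability.Cryptography

end
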